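import Summits.Ventures.YMGap.Thresholds.FluxBoundFour
import Summits.QuantumFields.BalabanUV.InfraRed.StrongCouplingTwelveSeventhsCovariance
import HarnessLib

/-!
# The ball-flux certificate, rung 2/3: the one-link covariance bound `|Cov_{ν_B}(φ, 2 Re tr(· Δ))| ≤ L ‖Δ‖_F` on the ball `‖B‖_op ≤ 1` (pub-ymgap track (a), A4-K
kernel port) — strong-coupling bookkeeping for the slab area-law door; no mass-gap claim

HONEST FRAMING. This file is the tree's `StrongCouplingTwelveSeventhsCovariance` / the cell's `QuarterCovarianceThree`
(pub-balaban J-SC16k: rotate the tilt axis, centre, normal component of a divergence-managed test field, Lipschitz–flux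
inequality, ball certificate) with ONE change: on tilts `3 ≤ κ ≤ 4` the order-two test field is replaced by the quadratic
small-divergence field of `PolyFluxField` (p1, cell pub-ymgap), `V(y) = d′ + p(P(y₀)·1 + Q(y₀)·y)`, `P(t) = a₀ + a₁t + a₂t²`,
`a₀ = 1039/1000 − 109κ/1000`, `a₁ = −109/1000 + 76κ/1000`, `a₂ = 86/1000 − 43κ/1000`, `Q(t) = t − τ − tP(t)`, whose flux
side is bounded by `PolyFluxLambda` (λ-trick), expanded by `PolyFluxMoments` and certified by `BallCertificateFour`
(engine-2's two recentred pieces).  `flux_witness4` packages, for every `0 < κ ≤ 4`, an admissible field with the displayed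
trace and flux `≤ (Z/4)·n`; `quarterCovariance4` is the covariance bound for every `B` with `‖B‖_op ≤ 1` (`= 3β_W/2` at Wilson
`β_W = 2/3`), every direction `Δ`, every bounded measurable `L`-Lipschitz `φ`.  Part 4 (`QuarterModulusTwoThirds`) integrates it
along segments to `OneLinkKRModulusSU2 β_W (1/4)` for `0 ≤ β_W ≤ 2/3`.  A one-link (single-site) statement only: nothing about
lattice measures is asserted here; no number of any ledger moves in this file; no mass-gap claim.
-/
noncomputable section

open MeasureTheory Filter Finset Real
open scoped NNReal Quaternion Matrix ComplexConjugate BigOperators Matrix.Norms.Frobenius ContDiff Topology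
  RealInnerProductSpace

open Matrix Complex
open Literature.MathematicalPhysics.QuantumLattice (su2Quat quatMatrix quatMatrix_mul quatMatrix_su2Quat norm_su2Quat)
open Literature.MathematicalPhysics.QuantumFieldTheory
open Literature.MathematicalPhysics.QuantumFieldTheory.SUNBakryEmery
open Literature.MathematicalPhysics.QuantumFieldTheory.Balaban1983to89.StrongCouplingVarianceWindow (qI qJ qK)
open Literature.MathematicalPhysics.QuantumLattice (fundamentalRep fundamentalLatticeRep)
open Literature.MathematicalPhysics.QuantumFieldTheory.Balaban1983to89
open Literature.MathematicalPhysics.QuantumFieldTheory.Balaban1983to89.StrongCouplingVarianceWindow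
open Literature.MathematicalPhysics.QuantumFieldTheory.Balaban1983to89.StrongCouplingKernelWindow
open Literature.MathematicalPhysics.QuantumFieldTheory.Balaban1983to89.StrongCouplingDobrushinWindow
open Literature.MathematicalPhysics.QuantumFieldTheory.Balaban1983to89.StrongCouplingTorusWindow
open Literature.MathematicalPhysics.QuantumFieldTheory.Balaban1983to89.StrongCouplingOpenWindow
open Literature.Probability.LatticeModels
open Summit.QuantumFields.BalabanUV.InfraRed.StrongCouplingSixFifthsVariance
open Summit.QuantumFields.BalabanUV.InfraRed.StrongCouplingReflection
open Summit.QuantumFields.BalabanUV.InfraRed.StrongCouplingTransverseMoment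

open Summit.QuantumFields.BalabanUV.InfraRed.StrongCouplingSphereCalculus (radialDiv quatOfMat quatOfMat_coe)
open Summit.QuantumFields.BalabanUV.InfraRed.StrongCouplingLipschitzFlux (abs_integral_lipschitz_mul_inner_le)
open Summit.QuantumFields.BalabanUV.InfraRed.StrongCouplingFluxField
open Summit.QuantumFields.BalabanUV.InfraRed.StrongCouplingFluxMoments
open Summit.QuantumFields.BalabanUV.InfraRed.StrongCouplingFluxLambda
open Summit.QuantumFields.BalabanUV.InfraRed.StrongCouplingCertArith (le_sqrt_mul_sqrt_of_forall add_mul_le_of_cert)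
open Summit.QuantumFields.BalabanUV.InfraRed.StrongCouplingBallCertificate
open Summit.QuantumFields.BalabanUV.InfraRed.StrongCouplingQuarterCovariance

namespace Summit.Ventures.YMGap.QuarterCovarianceFour

open Summit.QuantumFields.BalabanUV.InfraRed.StrongCouplingFluxCovariance (inner_coe_left re_mul_coe)
open Summit.QuantumFields.BalabanUV.InfraRed.StrongCouplingEightFifthsBrackets
open Summit.QuantumFields.BalabanUV.InfraRed.StrongCouplingTwelveSeventhsBrackets
open Summit.Ventures.YMGap.FluxBoundFour (flux_witness4)

/-! ## 1. The one-link covariance bound on the ball `‖B‖_op ≤ 1` -/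

/-- **One-link covariance bound on the ball `‖B‖_op ≤ 1`.**  For every `B` with `‖B‖_op ≤ 1`, every `Δ`, and
every bounded measurable `φ` that is `L`-Lipschitz for the Frobenius distance on `SU(2)`:
`|Cov_{ν_B}(φ, 2 Re tr(· Δ))| ≤ L ‖Δ‖_F`, `ν_B = σ.tilted (2 Re tr(· B))` — the tree's `quarterCovariance127` proof
(pub-balaban J-SC16k) with `κ = 4|qp B| ≤ 4` and the abstract flux witness of `flux_witness4`. [folklore] -/
theorem quarterCovariance4 (B Δ : Matrix (Fin 2) (Fin 2) ℂ) (hB : matrixOpNorm B ≤ 1)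
    (φ : Matrix.specialUnitaryGroup (Fin 2) ℂ → ℝ) (L : ℝ) (hφm : Measurable φ) (hφb : ∃ C, ∀ s, |φ s| ≤ C)
    (hL : 0 ≤ L) (hφL : ∀ a b, |φ a - φ b| ≤ L * suFrobDist a b) :
    |∫ s, φ s * pot Δ s ∂((haarProbability (Matrix.specialUnitaryGroup (Fin 2) ℂ)).tilted (pot B)) -
        (∫ s, φ s ∂((haarProbability (Matrix.specialUnitaryGroup (Fin 2) ℂ)).tilted (pot B))) *
          ∫ s, pot Δ s ∂((haarProbability (Matrix.specialUnitaryGroup (Fin 2) ℂ)).tilted (pot B))|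
      ≤ L * frobNorm Δ := by
  by_cases hm : qp B = 0
  · exact cov_pot_le_of_transverse B Δ (by rw [hm, star_zero, mul_zero, Quaternion.re_zero]) hφm hφb hL hφL
  obtain ⟨C, hC⟩ := hφb
  obtain ⟨y, hy1, hy⟩ := exists_unit_mul_eq_norm (qp B)
  have hmpos : 0 < ‖qp B‖ := norm_pos_iff.2 hm
  obtain ⟨κ, hκ⟩ : ∃ κ : ℝ, κ = 4 * ‖qp B‖ := ⟨_, rfl⟩
  have hκ0 : 0 < κ := by rw [hκ]; positivity
  obtain ⟨u0, hu0def⟩ : ∃ u : Matrix.specialUnitaryGroup (Fin 2) ℂ, u = unitSU2 y hy1 := ⟨_, rfl⟩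
  have hu0 : su2Quat u0 = y := by rw [hu0def]; exact su2Quat_unitSU2 y hy1
  -- `κ ≤ 4` from the ball `‖B‖_op ≤ 1`
  have hκ1 : κ ≤ 4 := by
    have h1 := abs_re_trace_su2_mul_le_opNorm u0 B
    have h2 : pot B u0 = 2 * ((u0 : Matrix (Fin 2) (Fin 2) ℂ) * B).trace.re := rfl
    have h3 : pot B u0 = κ := by rw [pot_eq, hu0, hy, Quaternion.re_coe, hκ]
    have h4 := le_abs_self (((u0 : Matrix (Fin 2) (Fin 2) ℂ) * B).trace.re)
    linarith
  -- the potentials after the right rotation by `u⁰`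
  have hpotB : ∀ g, pot B (g * u0) = κ * (su2Quat g).re := fun g => by
    rw [pot_eq, su2Quat_mul, hu0, mul_assoc, hy, re_mul_coe, hκ]; ring
  obtain ⟨d, hd⟩ : ∃ d : ℍ, d = star (y * qp Δ) := ⟨_, rfl⟩
  have hpotΔ : ∀ g, pot Δ (g * u0) = 4 * ⟪d, su2Quat g⟫ := fun g => by
    rw [pot_eq, su2Quat_mul, hu0, mul_assoc, hd, Quaternion.inner_def, ← star_mul, Quaternion.re_star]
  have hnd : ‖d‖ = ‖qp Δ‖ := by rw [hd, norm_star, norm_mul, hy1, one_mul]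
  obtain ⟨p, hp⟩ : ∃ p : ℝ, p = d.re := ⟨_, rfl⟩
  obtain ⟨d', hd'⟩ : ∃ d' : ℍ, d' = d - (p : ℍ) := ⟨_, rfl⟩
  have hd're : d'.re = 0 := by rw [hd', Quaternion.re_sub, Quaternion.re_coe, hp, sub_self]
  have hdd : d = d' + (p : ℍ) := by rw [hd', sub_add_cancel]
  have hn2 : ‖d'‖ ^ 2 + p ^ 2 = ‖qp Δ‖ ^ 2 := by
    have h := norm_sq_affine d' hd're p 0 1 norm_one
    rw [zero_smul, add_zero, ← hdd, hnd] at h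
    linarith
  have hdx : ∀ g, ⟪d, su2Quat g⟫ = ⟪d', su2Quat g⟫ + p * (su2Quat g).re := fun g => by
    rw [hdd, inner_add_left, inner_coe_left]
  -- the two normalising moments
  obtain ⟨Z, hZ⟩ : ∃ Z : ℝ, Z = ∫ g, Real.exp (κ * (su2Quat g).re)
    ∂haarProbability (Matrix.specialUnitaryGroup (Fin 2) ℂ) := ⟨_, rfl⟩
  obtain ⟨Zp, hZp⟩ : ∃ Zp : ℝ, Zp = ∫ g, (su2Quat g).re * Real.exp (κ * (su2Quat g).re)
    ∂haarProbability (Matrix.specialUnitaryGroup (Fin 2) ℂ) := ⟨_, rfl⟩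
  have hexpF := integrable_exp_pot B
  have hZrot : ∫ s, Real.exp (pot B s) ∂haarProbability (Matrix.specialUnitaryGroup (Fin 2) ℂ) = Z := by
    have h := integral_mul_right_eq_self (μ := haarProbability (Matrix.specialUnitaryGroup (Fin 2) ℂ))
      (fun s : Matrix.specialUnitaryGroup (Fin 2) ℂ => Real.exp (pot B s)) u0
    simp only [hpotB] at h
    rw [hZ, ← h]
  have hZpos : 0 < Z := by rw [← hZrot]; exact integral_exp_pos hexpF
  have hZne : Z ≠ 0 := hZpos.ne'
  -- the tilted law: integrability and centring
  haveI : IsProbabilityMeasure ((haarProbability (Matrix.specialUnitaryGroup (Fin 2) ℂ)).tilted (pot B)) :=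
    isProbabilityMeasure_tilted hexpF
  have hpm : Measurable (pot Δ) := (continuous_pot Δ).measurable
  have hφi : Integrable φ ((haarProbability (Matrix.specialUnitaryGroup (Fin 2) ℂ)).tilted (pot B)) :=
    integrable_of_measurable_of_abs_le hφm hC
  have hφpi : Integrable (fun s => φ s * pot Δ s) ((haarProbability (Matrix.specialUnitaryGroup (Fin 2) ℂ)).tilted (pot B)) :=
    integrable_of_measurable_of_abs_le (hφm.mul hpm) (C := C * (2 * (Real.sqrt 2 * frobNorm Δ))) fun s => by
      rw [abs_mul]; exact mul_le_mul (hC s) (abs_pot_le Δ s) (abs_nonneg _) ((abs_nonneg _).trans (hC s))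
  obtain ⟨E3, hE3⟩ : ∃ E : ℝ, E = ∫ s, pot Δ s ∂((haarProbability (Matrix.specialUnitaryGroup (Fin 2) ℂ)).tilted (pot B)) :=
    ⟨_, rfl⟩
  have hc1 : ∫ s, φ s * pot Δ s ∂((haarProbability (Matrix.specialUnitaryGroup (Fin 2) ℂ)).tilted (pot B)) -
      (∫ s, φ s ∂((haarProbability (Matrix.specialUnitaryGroup (Fin 2) ℂ)).tilted (pot B))) *
        ∫ s, pot Δ s ∂((haarProbability (Matrix.specialUnitaryGroup (Fin 2) ℂ)).tilted (pot B)) =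
      ∫ s, φ s * (pot Δ s - E3) ∂((haarProbability (Matrix.specialUnitaryGroup (Fin 2) ℂ)).tilted (pot B)) := by
    have h : ∫ s, φ s * (pot Δ s - E3) ∂((haarProbability (Matrix.specialUnitaryGroup (Fin 2) ℂ)).tilted (pot B)) =
        ∫ s, φ s * pot Δ s ∂((haarProbability (Matrix.specialUnitaryGroup (Fin 2) ℂ)).tilted (pot B)) -
        ∫ s, E3 * φ s ∂((haarProbability (Matrix.specialUnitaryGroup (Fin 2) ℂ)).tilted (pot B)) := by
      rw [← integral_sub hφpi (hφi.const_mul E3)]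
      refine integral_congr_ae (ae_of_all _ fun s => ?_)
      ring
    rw [h, integral_const_mul, ← hE3]
    ring
  -- the mean `E₃ = ν_B(pot Δ) = 4 p Z′/Z`
  have hq1 : Continuous fun g : Matrix.specialUnitaryGroup (Fin 2) ℂ => su2Quat g := by
    have h : Continuous fun g : Matrix.specialUnitaryGroup (Fin 2) ℂ => quatOfMat (g : Matrix (Fin 2) (Fin 2) ℂ) :=
      (LinearMap.continuous_of_finiteDimensional quatOfMat).comp continuous_subtype_val
    simpa only [quatOfMat_coe] using h
  have hq : Continuous fun g : Matrix.specialUnitaryGroup (Fin 2) ℂ => (su2Quat g).re := Quaternion.continuous_re.comp hq1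
  have hE3' : E3 = 4 * p * Zp / Z := by
    rw [hE3, integral_tilted]
    simp_rw [smul_eq_mul, div_mul_eq_mul_div]
    rw [integral_div, hZrot]
    have h := integral_mul_right_eq_self (μ := haarProbability (Matrix.specialUnitaryGroup (Fin 2) ℂ))
      (fun s : Matrix.specialUnitaryGroup (Fin 2) ℂ => Real.exp (pot B s) * pot Δ s) u0
    simp only [hpotB, hpotΔ, hdx] at h
    rw [← h]
    have i1 : Integrable (fun g : Matrix.specialUnitaryGroup (Fin 2) ℂ => ⟪d', su2Quat g⟫ * Real.exp (κ * (su2Quat g).re))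
        (haarProbability (Matrix.specialUnitaryGroup (Fin 2) ℂ)) := integrable_of_continuous_SUN (by fun_prop) _
    have i2 : Integrable (fun g : Matrix.specialUnitaryGroup (Fin 2) ℂ => (su2Quat g).re * Real.exp (κ * (su2Quat g).re))
        (haarProbability (Matrix.specialUnitaryGroup (Fin 2) ℂ)) := integrable_of_continuous_SUN (by fun_prop) _
    have i12 : Integrable (fun g : Matrix.specialUnitaryGroup (Fin 2) ℂ => 4 * (⟪d', su2Quat g⟫ * Real.exp (κ * (su2Quat g).re)) +
        4 * p * ((su2Quat g).re * Real.exp (κ * (su2Quat g).re))) (haarProbability (Matrix.specialUnitaryGroup (Fin 2) ℂ)) :=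
      (i1.const_mul _).add (i2.const_mul _)
    have e : ∫ g, Real.exp (κ * (su2Quat g).re) * (4 * (⟪d', su2Quat g⟫ + p * (su2Quat g).re))
        ∂haarProbability (Matrix.specialUnitaryGroup (Fin 2) ℂ) =
        4 * (∫ g, ⟪d', su2Quat g⟫ * Real.exp (κ * (su2Quat g).re) ∂haarProbability (Matrix.specialUnitaryGroup (Fin 2) ℂ)) +
        4 * p * ∫ g, (su2Quat g).re * Real.exp (κ * (su2Quat g).re) ∂haarProbability (Matrix.specialUnitaryGroup (Fin 2) ℂ) := by
      rw [← integral_const_mul, ← integral_const_mul, ← integral_add (i1.const_mul _) (i2.const_mul _)]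
      refine integral_congr_ae (ae_of_all _ fun g => ?_)
      ring
    have h0' := integral_inner_mul_eq_zero hd're (fun t => Real.exp (κ * t))
    beta_reduce at h0'
    rw [e, h0', ← hZp]
    ring
  -- Lipschitz transport of `φ` along the rotation
  have hψL : ∀ a b : Matrix.specialUnitaryGroup (Fin 2) ℂ, |φ (a * u0) - φ (b * u0)| ≤ L * suFrobDist a b := fun a b => by
    have h := hφL (a * u0) (b * u0)
    rwa [suFrobDist_eq_sqrt_two_mul, su2Quat_mul, su2Quat_mul, hu0, ← sub_mul, norm_mul, hy1, mul_one,
      ← suFrobDist_eq_sqrt_two_mul] at h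
  -- the flux witness (abstract): smooth, sphere-mean-zero trace, the displayed trace, flux ≤ (Z/4)·‖qp Δ‖
  obtain ⟨W, hWs, hW0, htr, hflux⟩ := flux_witness4 hκ0 hκ1 hd're hn2 (norm_nonneg (qp Δ)) hZ hZp
  have hnum : ∫ s, Real.exp (pot B s) * (φ s * (pot Δ s - E3)) ∂haarProbability (Matrix.specialUnitaryGroup (Fin 2) ℂ) =
      4 * ∫ g, φ (g * u0) * ⟪W (su2Quat g), su2Quat g⟫ ∂haarProbability (Matrix.specialUnitaryGroup (Fin 2) ℂ) := by
    have h := integral_mul_right_eq_self (μ := haarProbability (Matrix.specialUnitaryGroup (Fin 2) ℂ))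
      (fun s : Matrix.specialUnitaryGroup (Fin 2) ℂ => Real.exp (pot B s) * (φ s * (pot Δ s - E3))) u0
    simp only [hpotB, hpotΔ, hdx] at h
    rw [← h, ← integral_const_mul]
    refine integral_congr_ae (ae_of_all _ fun g => ?_)
    beta_reduce
    rw [htr g, hE3']
    field_simp
    ring
  -- the Lipschitz–flux inequality
  have h15 := abs_integral_lipschitz_mul_inner_le (φ := fun g => φ (g * u0)) hL hψL hWs hW0
  beta_reduce at h15
  -- assembly
  rw [hc1, integral_tilted]
  simp_rw [smul_eq_mul, div_mul_eq_mul_div]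
  rw [integral_div, hZrot, hnum, abs_div, abs_of_pos hZpos, div_le_iff₀ hZpos, abs_mul,
    abs_of_pos (by norm_num : (0:ℝ) < 4)]
  have hs := sqrt_two_mul_norm_qp_le Δ
  have h2L : 0 ≤ Real.sqrt 2 * L := mul_nonneg (Real.sqrt_nonneg _) hL
  calc 4 * |∫ g, φ (g * u0) * ⟪W (su2Quat g), su2Quat g⟫ ∂haarProbability (Matrix.specialUnitaryGroup (Fin 2) ℂ)|
      ≤ 4 * (Real.sqrt 2 * L * (Z / 4 * ‖qp Δ‖)) := by
        have := mul_le_mul_of_nonneg_left hflux h2L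
        linarith
    _ = (Real.sqrt 2 * ‖qp Δ‖) * L * Z := by ring
    _ ≤ frobNorm Δ * L * Z := mul_le_mul_of_nonneg_right (mul_le_mul_of_nonneg_right hs hL) hZpos.le
    _ = L * frobNorm Δ * Z := by ring

end Summit.Ventures.YMGap.QuarterCovarianceFour
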